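import Summits.BirchSwinnertonDyer.BirchSwinnertonDyer.Theorems.KimAtThreeD7uRefinedModule
import Summits.BirchSwinnertonDyer.Rank1Residual.GaloisImage.KolyvaginDerivativeEulerRelation
import HarnessLib

/-!
# D7-u, file C3: the Euler-system norm relation in COCYCLE-COMBINATION form (route W2 =
# `KimAtThreeKolyvagin`, crux 19560 (C3) / TamDiv∞; seat `bsd-addord-w2-tamdiv`)

n1011-p11's F3a (`Derivative.sum_conjMap_pow_resLe_eq_eulerFactorOp`, [Rubin00] proof of Lemma
4.4.2) reads the Euler-system axiom at a common level `U` as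
`Σ_{j<N} σ^j · res c_{i,rq} = P_q(Fr_q⁻¹) · res c_{i,r}` in `H¹(U, T)`.  The refined THEOREM A2
transports this identity through the refined reduction `ρ̂` of files B/C1/C2, which is defined on
COCYCLES; this file restates F3a as an equality of the classes of two explicit linear combinations
of conjugate cocycles (`oneCocycleClass_normCombination_eq`):

  `[Σ_{j<N} 1 • (σ^j · φ)] = [Σ_{n ≤ deg P} (coeff_n P) • ((Fr⁻¹)^n · φ')]`

for representatives `φ` of `res c_{i,rq}` and `φ'` of `res c_{i,r}`, where `P = P_q(· | T*)` is
Rubin's Euler factor (`rubinEulerFactor`) and `Fr` is any element of `Γ_K` congruent to an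
arithmetic Frobenius at `q` modulo `U` (`hFrw`; F1's `Fr_q⁻¹` may be replaced by a word in the
chosen generators).  No definition, no new mathematics: F3a + `eulerFactorOp`/`frobeniusInvOp`
unfolded + `aeval_eq_sum_range` + `conjMap_hom_pow_apply` + `oneCocycleClass_combination`.

References: K. Rubin, *Euler Systems* (2000), Def. 2.1.1, Def. 4.4.1, Lemma 4.4.2 (proof).
-/

set_option autoImplicit false
-- the Theorems namespace of a single-conjunct summit repeats the summit name by design (D-0017)
set_option linter.dupNamespace false

noncomputable section

open CategoryTheory Function Finset Polynomial Field IsDedekindDomain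
open scoped NumberField
open Literature.NumberTheory.GaloisRepresentations
open Literature.NumberTheory.EllipticCurves (subgroupConj subgroupConj_apply_coe)
open Summit.BirchSwinnertonDyer.Rank1Residual.GaloisImage
open Summit.BirchSwinnertonDyer.Rank1Residual.GaloisImage.Derivative

universe u v w

namespace Summit.BirchSwinnertonDyer.BirchSwinnertonDyer.Theorems.KimAtThreeD7uRefined

variable {K : Type u} [Field K] [NumberField K] {ι : Type w} [Preorder ι] [OrderBot ι]
variable {A : Type v} [CommRing A] [TopologicalSpace A]
variable {M : Type u} [AddCommGroup M] [Module A M] [TopologicalSpace M] [IsTopologicalAddGroup M]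
  [ContinuousSMul A M] [Module.Free A M] [Module.Finite A M]
variable {L : EulerSystemLevels K ι} {T : GaloisRep K A M} {p : ℕ} [Fact p.Prime] [Algebra ℤ_[p] A]
variable {c : ∀ (i : ι) (r : L.Ideals), H1 T (L.level i r.1)}

/-- Local notation: `𝔠⟦U, g⟧ φ` = the conjugate cocycle `x ↦ g • φ(g⁻¹ x g)` on `U`
(coefficients `T`). -/
local notation3 (prettyPrint := false) "𝔠⟦" U ", " g "⟧" =>
  contOneCocycles.pullback (subgroupConj U g) (conjRepHom (ContinuousRep.toTopRep T) U g)

omit [NumberField K] in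
/-- **`Fr⁻¹` may be replaced by any element congruent to it modulo `U`** in the Euler-factor
operator: `P(Fr⁻¹ | T*)(w⁻¹ ·) = P(Fr⁻¹ | T*)(Fr⁻¹ ·)` on `H¹(U, T)` when `Fr⁻¹ w ∈ U`
(the polynomial is still that of `Fr`). [folklore] -/
theorem eulerFactorOp_eq_aeval_of_inv_mul_mem {U : Subgroup (absoluteGaloisGroup K)} [U.Normal]
    (Fr w : absoluteGaloisGroup K) (hFrw : Fr⁻¹ * w ∈ U) (y : H1 T U) :
    eulerFactorOp T U p Fr y =
      aeval (frobeniusInvOp T U w)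
        (rubinEulerFactor T.toRepresentation (cyclotomicCharacterToUnits K p A) Fr) y := by
  rw [eulerFactorOp, frobeniusInvOp_eq_of_inv_mul_mem T U hFrw]

/-- **The norm relation as an equality of classes of cocycle combinations.**  In the setting of
F3a (`sum_conjMap_pow_resLe_eq_eulerFactorOp`): an Euler system `c`, a usable prime `q ∉ r`
ramified in `F_i(rq)`, an arithmetic Frobenius `Fr` at `q` and any `w` with `Fr⁻¹ w ∈ U`, a normal
`U ≤ Gal(K̄/F_i(rq))`, `σ ∈ Gal(K̄/F_i(r))` whose powers `σ^j` (`j < N`) represent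
`Gal(F_i(rq)/F_i(r))`; and REPRESENTATIVES `φ` of `res_U c_{i,rq}`, `φ'` of `res_U c_{i,r}`.  Then
`[Σ_{j<N} 1 • (σ^j · φ)] = [Σ_{n ≤ deg P} P_n • ((w⁻¹)^n · φ')]` in `H¹(U, T)`, `P = P_q(· | T*)`
Rubin's Euler factor. [cite: Rubin2000, Lemma 4.4.2 (proof)] -/
theorem oneCocycleClass_normCombination_eq (hc : IsEulerSystem L T p c) (i : ι) (r : L.Ideals)
    (q : HeightOneSpectrum (𝓞 K)) (hq : q ∈ L.primes) (hqr : q ∉ r.1)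
    (hram : ¬ SubgroupIsUnramifiedAt K (L.level i (r.cons q hq).1) q)
    (Fr : absoluteGaloisGroup K) (hFr : IsArithFrobAtPlace K q Fr)
    {U : Subgroup (absoluteGaloisGroup K)} [U.Normal] (hU : U ≤ L.level i (r.cons q hq).1)
    (w : absoluteGaloisGroup K) (hFrw : Fr⁻¹ * w ∈ U)
    (σ : absoluteGaloisGroup K) (N : ℕ) (hσ : σ ∈ L.level i r.1)
    (hcov : ∀ g ∈ L.level i r.1, ∃ j < N, (σ ^ j)⁻¹ * g ∈ L.level i (r.cons q hq).1)
    (hinj : ∀ j₁ < N, ∀ j₂ < N, (σ ^ j₁)⁻¹ * σ ^ j₂ ∈ L.level i (r.cons q hq).1 → j₁ = j₂)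
    (φ : contOneCocycles (subgroupRep T.toTopRep U))
    (hφ : oneCocycleClass _ φ = resLe T.toTopRep hU 1 (c i (r.cons q hq)))
    (φ' : contOneCocycles (subgroupRep T.toTopRep U))
    (hφ' : oneCocycleClass _ φ' = resLe T.toTopRep (hU.trans (L.level_insert_le i r.1 q)) 1 (c i r)) :
    oneCocycleClass (subgroupRep T.toTopRep U) (∑ j ∈ range N, (1 : A) • 𝔠⟦U, σ ^ j⟧ φ) =
      oneCocycleClass (subgroupRep T.toTopRep U)
        (∑ n ∈ range
          ((rubinEulerFactor T.toRepresentation (cyclotomicCharacterToUnits K p A) Fr).natDegree + 1),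
          (rubinEulerFactor T.toRepresentation (cyclotomicCharacterToUnits K p A) Fr).coeff n •
            𝔠⟦U, (w⁻¹) ^ n⟧ φ') := by
  rw [oneCocycleClass_combination, oneCocycleClass_combination, hφ, hφ']
  have key := sum_conjMap_pow_resLe_eq_eulerFactorOp hc i r q hq hqr hram Fr hFr hU σ N hσ hcov hinj
  simp only [one_smul]
  rw [key, eulerFactorOp_eq_aeval_of_inv_mul_mem Fr w hFrw, aeval_eq_sum_range, LinearMap.sum_apply]
  refine Finset.sum_congr rfl fun n _ => ?_
  rw [LinearMap.smul_apply, frobeniusInvOp, conjMap_hom_pow_apply]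


/-- **Words in the generators reach every element of `Γ_i` modulo `U_r = Gal(K̄/F_i(r))`**: for
`g ∈ Gal(K̄/F_i)` there is `w` in the subgroup generated by the `σ_ℓ` (`ℓ ∈ r`) with `w⁻¹ g ∈ U_r`
(F3b's bookkeeping `exists_mem_closure_inv_mul_mem` + `mem_level_of_forall`). [folklore] -/
theorem exists_mem_closure_inv_mul_mem_level (i : ι) (r : L.Ideals)
    (σ : HeightOneSpectrum (𝓞 K) → absoluteGaloisGroup K) (N : HeightOneSpectrum (𝓞 K) → ℕ)
    (hσp : ∀ ℓ ∈ r.1, σ ℓ ∈ L.pLevel i)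
    (hσ : ∀ ℓ ∈ r.1, ∀ q ∈ r.1, q ≠ ℓ → σ ℓ ∈ L.tameLevel q)
    (hcov : ∀ ℓ ∈ r.1, ∀ g : absoluteGaloisGroup K, ∃ j < N ℓ, (σ ℓ ^ j)⁻¹ * g ∈ L.tameLevel ℓ)
    (g : absoluteGaloisGroup K) (hg : g ∈ (L.pLevel i : Set (absoluteGaloisGroup K))) :
    ∃ w ∈ Subgroup.closure (σ '' (r.1 : Set (HeightOneSpectrum (𝓞 K)))), w⁻¹ * g ∈ L.level i r.1 := by
  have hcl : ∀ w ∈ Subgroup.closure (σ '' (r.1 : Set (HeightOneSpectrum (𝓞 K)))), w ∈ L.pLevel i := by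
    intro w hw
    induction hw using Subgroup.closure_induction with
    | mem x hx =>
      obtain ⟨q, hq, rfl⟩ := hx
      exact hσp q (Finset.mem_coe.mp hq)
    | one => exact Subgroup.one_mem _
    | mul a b _ _ iha ihb => exact Subgroup.mul_mem _ iha ihb
    | inv a _ iha => exact Subgroup.inv_mem _ iha
  obtain ⟨w, hw, hwq⟩ := exists_mem_closure_inv_mul_mem L σ N r.1 hσ hcov g
  exact ⟨w, hw, mem_level_of_forall L (Subgroup.mul_mem _ (Subgroup.inv_mem _ (hcl w hw)) hg) hwq⟩

/-- `σ_ℓ ∈ Gal(K̄/F_i(s))` for `ℓ ∉ s ⊆ r` (F3b bookkeeping). [folklore] -/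
theorem sigma_mem_level_of_not_mem (i : ι) (r : L.Ideals)
    (σ : HeightOneSpectrum (𝓞 K) → absoluteGaloisGroup K)
    (hσp : ∀ ℓ ∈ r.1, σ ℓ ∈ L.pLevel i)
    (hσ : ∀ ℓ ∈ r.1, ∀ q ∈ r.1, q ≠ ℓ → σ ℓ ∈ L.tameLevel q)
    {s : Finset (HeightOneSpectrum (𝓞 K))} (hs : s ⊆ r.1) (ℓ : HeightOneSpectrum (𝓞 K))
    (hℓ : ℓ ∈ r.1) (hℓs : ℓ ∉ s) : σ ℓ ∈ L.level i s :=
  mem_level_of_forall L (hσp ℓ hℓ) fun q hq => hσ ℓ hℓ q (hs hq) (fun h => hℓs (h ▸ hq))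

open scoped Classical in
/-- **The norm relation in combination form, in THEOREM A2's bookkeeping** (`s ⊆ r`, `ℓ ∈ s`,
`s' = s ∖ {ℓ}`, a normal `U ≤ U_r`, representatives `φ` of `res_U c_{i,s}` and `φ'` of
`res_U c_{i,s'}`): `[Σ_{j<N_ℓ} 1 • (σ_ℓ^j · φ)] = [Σ_n P_{ℓ,n} • ((Fr_ℓ⁻¹)^n · φ')]` in `H¹(U, T)`
(`oneCocycleClass_normCombination_eq` after F3b's translation of the hypotheses to `r₀.cons ℓ`).
[cite: Rubin2000, Lemma 4.4.2 (proof)] -/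
theorem oneCocycleClass_normCombination_eq_of_subset (hc : IsEulerSystem L T p c) (i : ι)
    (r : L.Ideals) (σ : HeightOneSpectrum (𝓞 K) → absoluteGaloisGroup K)
    (N : HeightOneSpectrum (𝓞 K) → ℕ) (Fr : HeightOneSpectrum (𝓞 K) → absoluteGaloisGroup K)
    (hσp : ∀ ℓ ∈ r.1, σ ℓ ∈ L.pLevel i)
    (hσ : ∀ ℓ ∈ r.1, ∀ q ∈ r.1, q ≠ ℓ → σ ℓ ∈ L.tameLevel q)
    (hcov : ∀ ℓ ∈ r.1, ∀ g : absoluteGaloisGroup K, ∃ j < N ℓ, (σ ℓ ^ j)⁻¹ * g ∈ L.tameLevel ℓ)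
    (hinj : ∀ ℓ ∈ r.1, ∀ j₁ < N ℓ, ∀ j₂ < N ℓ, (σ ℓ ^ j₁)⁻¹ * σ ℓ ^ j₂ ∈ L.tameLevel ℓ → j₁ = j₂)
    (hFr : ∀ ℓ ∈ r.1, IsArithFrobAtPlace K ℓ (Fr ℓ))
    (hram : ∀ ℓ ∈ r.1, ∀ s ⊆ r.1, ℓ ∉ s → ¬ SubgroupIsUnramifiedAt K (L.level i (insert ℓ s)) ℓ)
    {U : Subgroup (absoluteGaloisGroup K)} [U.Normal] (hUr : U ≤ L.level i r.1)
    {s : Finset (HeightOneSpectrum (𝓞 K))} (hs : s ⊆ r.1) {ℓ : HeightOneSpectrum (𝓞 K)} (hℓ : ℓ ∈ s)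
    (φ : contOneCocycles (subgroupRep T.toTopRep U))
    (hφ : oneCocycleClass _ φ =
      resLe T.toTopRep (hUr.trans (level_antitone L i hs)) 1 (c i ⟨s, fun q hq => r.2 q (hs hq)⟩))
    (φ' : contOneCocycles (subgroupRep T.toTopRep U))
    (hφ' : oneCocycleClass _ φ' =
      resLe T.toTopRep (hUr.trans (level_antitone L i ((Finset.erase_subset ℓ s).trans hs))) 1
        (c i ⟨s.erase ℓ, fun q hq => r.2 q (((Finset.erase_subset ℓ s).trans hs) hq)⟩)) :
    oneCocycleClass (subgroupRep T.toTopRep U) (∑ j ∈ range (N ℓ), (1 : A) • 𝔠⟦U, σ ℓ ^ j⟧ φ) =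
      oneCocycleClass (subgroupRep T.toTopRep U)
        (∑ n ∈ range
          ((rubinEulerFactor T.toRepresentation (cyclotomicCharacterToUnits K p A) (Fr ℓ)).natDegree + 1),
          (rubinEulerFactor T.toRepresentation (cyclotomicCharacterToUnits K p A) (Fr ℓ)).coeff n •
            𝔠⟦U, ((Fr ℓ)⁻¹) ^ n⟧ φ') := by
  have hs' : s.erase ℓ ⊆ r.1 := (Finset.erase_subset ℓ s).trans hs
  have hℓs' : ℓ ∉ s.erase ℓ := Finset.notMem_erase ℓ s
  let r₀ : L.Ideals := ⟨s.erase ℓ, fun q hq => r.2 q (hs' hq)⟩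
  have hℓp : ℓ ∈ L.primes := r.2 ℓ (hs hℓ)
  have hcons : (r₀.cons ℓ hℓp).1 = s := Finset.insert_erase hℓ
  have hsub : (⟨s, fun q hq => r.2 q (hs hq)⟩ : L.Ideals) = r₀.cons ℓ hℓp := Subtype.ext hcons.symm
  have hUc : U ≤ L.level i (r₀.cons ℓ hℓp).1 := hcons.symm ▸ hUr.trans (level_antitone L i hs)
  have hσ₀ : σ ℓ ∈ L.level i r₀.1 := sigma_mem_level_of_not_mem i r σ hσp hσ hs' ℓ (hs hℓ) hℓs'
  have hcov₀ : ∀ g ∈ L.level i r₀.1, ∃ j < N ℓ, (σ ℓ ^ j)⁻¹ * g ∈ L.level i (r₀.cons ℓ hℓp).1 := by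
    intro g hg
    obtain ⟨j, hj, hjg⟩ := hcov ℓ (hs hℓ) g
    refine ⟨j, hj, ?_⟩
    rw [EulerSystemLevels.Ideals.cons_val]
    have hmem : (σ ℓ ^ j)⁻¹ * g ∈ L.level i r₀.1 :=
      Subgroup.mul_mem _ (Subgroup.inv_mem _ (Subgroup.pow_mem _ hσ₀ j)) hg
    rw [EulerSystemLevels.mem_level_iff] at hmem ⊢
    refine ⟨hmem.1, fun q hq => ?_⟩
    rcases Finset.mem_insert.mp hq with rfl | hq
    · exact hjg
    · exact hmem.2 q hq
  have hinj₀ : ∀ j₁ < N ℓ, ∀ j₂ < N ℓ,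
      (σ ℓ ^ j₁)⁻¹ * σ ℓ ^ j₂ ∈ L.level i (r₀.cons ℓ hℓp).1 → j₁ = j₂ := by
    intro j₁ hj₁ j₂ hj₂ hmem
    rw [EulerSystemLevels.Ideals.cons_val, EulerSystemLevels.mem_level_iff] at hmem
    exact hinj ℓ (hs hℓ) j₁ hj₁ j₂ hj₂ (hmem.2 ℓ (Finset.mem_insert_self ℓ _))
  have hram₀ : ¬ SubgroupIsUnramifiedAt K (L.level i (r₀.cons ℓ hℓp).1) ℓ := by
    rw [EulerSystemLevels.Ideals.cons_val]
    exact hram ℓ (hs hℓ) (s.erase ℓ) hs' hℓs'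
  have hφs : oneCocycleClass _ φ = resLe T.toTopRep hUc 1 (c i (r₀.cons ℓ hℓp)) := by
    rw [hφ]
    clear hcov₀ hinj₀ hram₀
    revert hUc
    rw [← hsub]
    intro hUc
    rfl
  exact oneCocycleClass_normCombination_eq hc i r₀ ℓ hℓp hℓs' hram₀ (Fr ℓ) (hFr ℓ (hs hℓ)) hUc
    (Fr ℓ) (by rw [inv_mul_cancel (Fr ℓ)]; exact U.one_mem) (σ ℓ) (N ℓ) hσ₀ hcov₀ hinj₀ φ hφs φ' hφ'

end Summit.BirchSwinnertonDyer.BirchSwinnertonDyer.Theorems.KimAtThreeD7uRefined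

end
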